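import Summits.Ventures.QEC.Census.RefinedPairCertificate
import HarnessLib

/-!
# Certificates for CRSS's refined LP of the pair `(C, C′)`: soundness of the checker and the two-stage assembly

Venture QEC (cell `qec`, LADDER-QEC rung X1; row 06). Second file of the pair-certificate checker
(`RefinedPairCertificate.lean`: leaves `RLeafP`, trees `RTreeP`, the pure check `rleafOKP` / `checkP`, and the row
algebra). THIS file: the bundle of hypotheses `LeafHypP` (plain system, refined system of `(C, C⊥)`, refined system of
the even subcode `(C′, (C′)⊥)` [CalderbankEtAl1998, §7 Thm. 21 eq. (21) and (ii)], link `R′ ≤ R″`, split path), weak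
duality for a pair leaf (`not_leafHypP_of_rleafOKP`; the grid identity of `RefinedIPCertificateGrid.lean` serves both
blocks, the second at `k + e`), soundness of the tree checker, `not_crssRefinedPairFeasible_of_checkP` (one checked
tree per parity branch), and the assembly `no_additiveCode_of_pairCerts` of CRSS's two-stage special-bound argument
with the even-subcode block. HONEST FRAMING: nonexistence only; nothing here certifies a distance.
[cite: CalderbankEtAl1998, §7 (ii)–(iii) (printed p. 28)]; [cite: MacWilliamsSloane1977, Ch. 17 §4 Thm. 20].
-/

namespace Summit.Ventures.QEC.Census

open Finset Literature.InformationTheory.QuantumCodes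

section Soundness

variable {n k d e w₀ : ℕ} {A B W : ℕ → ℕ} {R Rp Rpp : ℕ → ℕ → ℕ → ℕ}

/-- All clauses used by a pair leaf: the plain system, the refined system, the refined system of the even subcode,
the link `R′ ≤ R″`, and the splits on the path. [cite: CalderbankEtAl1998, §7 Thm. 21 and (ii)] -/
structure LeafHypP (n k d e w₀ : ℕ) (path : List RSplit) (A B W : ℕ → ℕ) (R Rp Rpp : ℕ → ℕ → ℕ → ℕ) : Prop where
  /-- the plain integer system -/
  sys : CRSSIntSystem n k d A B W e
  /-- the refined system of `(C, C⊥)` -/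
  ref : CRSSRefinedSystem n k d w₀ A B R Rp
  /-- the refined system of `(C′, (C′)⊥)` -/
  ref2 : CRSSRefinedSystem n (k + e) 1 w₀ (evenPart A) W (evenPart₃ R) Rpp
  /-- the link `C⊥ ⊆ (C′)⊥` -/
  link : ∀ a b c, Rp a b c ≤ Rpp a b c
  /-- the splits on the path hold -/
  path : ∀ s ∈ path, s.Holds n w₀ A B W R Rp

/-- The even-weight part, cast to `ℤ`. [folklore] -/
theorem cast_evenPart₃ (R : ℕ → ℕ → ℕ → ℕ) (a b c : ℕ) :
    ((evenPart₃ R a b c : ℕ) : ℤ) = if Even (a + b + c) then (R a b c : ℤ) else 0 := by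
  unfold evenPart₃; split_ifs <;> simp

/-- **Weak duality for a pair leaf**: a pair leaf that checks refutes every solution of the pair system with the path's
splits. Column: proved (ours). [cite: MacWilliamsSloane1977, Ch. 17 §4 Thm. 20] -/
theorem not_leafHypP_of_rleafOKP {path : List RSplit} {L : RLeafP} (h : rleafOKP n k d e w₀ path L = true)
    (H : LeafHypP n k d e w₀ path A B W R Rp Rpp) : False := by
  have hsys := H.sys
  have href := H.ref
  have href2 := H.ref2
  have hlink := H.link
  obtain ⟨-, h0, h1, hsum, hpar, hB, hW, heq, hle, hBW, hpure⟩ := hsys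
  obtain ⟨hmR, hmRp, hid, hodd, hsup, htr, hcont, hceq, hz0, hzu⟩ := href
  obtain ⟨-, hmW, hid2, hodd2, hsup2, htr2, -, -, -, -⟩ := href2
  simp only [rleafOKP, gridTabF_eq, Bool.and_eq_true, List.all_eq_true, List.mem_range, decide_eq_true_eq,
    Bool.or_eq_true, Bool.not_eq_true', decide_eq_false_iff_not] at h
  set TP := gridTab (n - w₀) w₀ (gridX (n - w₀)) (gridY w₀) L.G.mus with hTP
  set TT := gridTab (n - w₀) w₀ ((gridX (n - w₀)).map tX) ((gridY w₀).map tY) L.G.mus with hTT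
  set TP2 := gridTab (n - w₀) w₀ (gridX (n - w₀)) (gridY w₀) L.mus2 with hTP2
  set TT2 := gridTab (n - w₀) w₀ ((gridX (n - w₀)).map tX) ((gridY w₀).map tY) L.mus2 with hTT2
  obtain ⟨⟨⟨⟨⟨hwn, hsig⟩, hssig⟩, hABW⟩, hRRR⟩, hrhs⟩ := h
  -- (1) base rows and (2) split rows
  have hbase := combRhs_le (n := n) (A := A) (B := B) (W := W) (baseRows n k d e) L.G.base hsig
    (sat_baseRows (n := n) h0 h1 hsum hpar hB hW heq hle hBW hpure)
  have hspl := splitRhs_le (n := n) (w₀ := w₀) (A := A) (B := B) (W := W) (R := R) (Rp := Rp) path L.G.smult hssig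
    H.path
  -- (3) marginal rows (three families)
  have hmargR := boxSum_marg_eq hwn L.G.lamR R A (fun j hj => margR_tri H.ref hj)
  have hmargRp := boxSum_marg_eq hwn L.G.lamRp Rp B (fun j hj => margRp_tri H.ref hj)
  have hmargW := boxSum_marg_eq hwn L.lamW Rpp W (fun j hj => margRp_tri H.ref2 hj)
  -- (4) the two grid identities
  have hpts : boxSum n w₀ (fun a b c =>
      (if b + c ≤ w₀ then (2 : ℤ) ^ (n - k) * get3 TP a b c else 0) * Rp a b c +
      (if b + c ≤ w₀ then -get3 TT a b c else 0) * R a b c) = 0 :=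
    grid_identity H.ref L.G.mus
  have hpts2 : boxSum n w₀ (fun a b c =>
      (if b + c ≤ w₀ then (2 : ℤ) ^ (n - (k + e)) * get3 TP2 a b c else 0) * Rpp a b c +
      (if b + c ≤ w₀ then -get3 TT2 a b c else 0) * (evenPart₃ R a b c)) = 0 :=
    grid_identity H.ref2 L.mus2
  have hpts2' : boxSum n w₀ (fun a b c =>
      (if b + c ≤ w₀ then (2 : ℤ) ^ (n - (k + e)) * get3 TP2 a b c else 0) * (Rpp a b c : ℤ) +
      (if b + c ≤ w₀ ∧ Even (a + b + c) then -get3 TT2 a b c else 0) * (R a b c : ℤ)) = 0 := by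
    refine Eq.trans ?_ hpts2
    unfold boxSum
    refine Finset.sum_congr rfl fun a _ => Finset.sum_congr rfl fun b _ => Finset.sum_congr rfl fun c _ => ?_
    beta_reduce
    rw [cast_evenPart₃]
    by_cases htri : b + c ≤ w₀ <;> by_cases hev : Even (a + b + c) <;> simp [htri, hev]
  -- (5) zero rows
  have hinv : ∀ a b c, (Odd c ∨ w₀ < b + c) → R a b c = 0 ∧ Rp a b c = 0 := by
    intro a b c hx
    rcases hx with hx | hx
    · exact hodd a b c hx
    · exact hsup a b c (Or.inr hx)
  have hinv2 : ∀ a b c, (Odd c ∨ w₀ < b + c) → Rpp a b c = 0 := by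
    intro a b c hx
    rcases hx with hx | hx
    · exact (hodd2 a b c hx).2
    · exact (hsup2 a b c (Or.inr hx)).2
  have hzero : boxSum n w₀ (fun a b c => (if Odd c ∨ w₀ < b + c then get3 L.G.zR a b c else 0) * (R a b c : ℤ) +
      (if Odd c ∨ w₀ < b + c then get3 L.G.zRp a b c else 0) * (Rp a b c : ℤ)) = 0 := by
    unfold boxSum
    refine Finset.sum_eq_zero fun a _ => Finset.sum_eq_zero fun b _ => Finset.sum_eq_zero fun c _ => ?_
    beta_reduce
    by_cases hc : Odd c ∨ w₀ < b + c
    · rw [(hinv a b c hc).1, (hinv a b c hc).2]; simp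
    · simp [hc]
  have hzero2 : boxSum n w₀ (fun a b c =>
      (if Odd c ∨ w₀ < b + c then get3 L.zRpp a b c else 0) * (Rpp a b c : ℤ)) = 0 := by
    unfold boxSum
    refine Finset.sum_eq_zero fun a _ => Finset.sum_eq_zero fun b _ => Finset.sum_eq_zero fun c _ => ?_
    beta_reduce
    by_cases hc : Odd c ∨ w₀ < b + c
    · rw [hinv2 a b c hc]; simp
    · simp [hc]
  -- (6) translation rows
  have htransR := boxSum_transRow_eq_zero (n := n) (w₀ := w₀) L.G.tR R (fun a b c hbc => (htr a b c hbc).1)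
  have htransRp := boxSum_transRow_eq_zero (n := n) (w₀ := w₀) L.G.tRp Rp (fun a b c hbc => (htr a b c hbc).2)
  have htransRpp := boxSum_transRow_eq_zero (n := n) (w₀ := w₀) L.tRpp Rpp (fun a b c hbc => (htr2 a b c hbc).2)
  -- (7) containment rows and link rows
  have hcontain : 0 ≤ boxSum n w₀ (fun a b c => get3 L.G.kap a b c * ((Rp a b c : ℤ) - R a b c)) := by
    unfold boxSum
    refine Finset.sum_nonneg fun a ha => Finset.sum_nonneg fun b hb => Finset.sum_nonneg fun c hc => ?_
    beta_reduce
    by_cases hx : Odd c ∨ w₀ < b + c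
    · rw [(hinv a b c hx).1, (hinv a b c hx).2]; simp
    by_cases hwt : d ≤ a + b + c
    · have hk : 0 ≤ get3 L.G.kap a b c := by
        rcases hRRR a (mem_range.1 ha) b (mem_range.1 hb) c (mem_range.1 hc) with hbad | ⟨⟨⟨⟨hk, -⟩, -⟩, -⟩, -⟩
        · exact absurd hbad hx
        · rcases hk with hk | hk
          · exact absurd hwt hk
          · exact hk
      have hge : (R a b c : ℤ) ≤ Rp a b c := by exact_mod_cast hcont a b c
      exact mul_nonneg hk (sub_nonneg.2 hge)
    · rw [hceq a b c (by omega), sub_self, mul_zero]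
  have hlink2 : 0 ≤ boxSum n w₀ (fun a b c => get3 L.kap2 a b c * ((Rpp a b c : ℤ) - Rp a b c)) := by
    unfold boxSum
    refine Finset.sum_nonneg fun a ha => Finset.sum_nonneg fun b hb => Finset.sum_nonneg fun c hc => ?_
    beta_reduce
    by_cases hx : Odd c ∨ w₀ < b + c
    · rw [(hinv a b c hx).2, hinv2 a b c hx]; simp
    · have hk : 0 ≤ get3 L.kap2 a b c := by
        rcases hRRR a (mem_range.1 ha) b (mem_range.1 hb) c (mem_range.1 hc) with hbad | ⟨⟨⟨⟨-, hk⟩, -⟩, -⟩, -⟩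
        · exact absurd hbad hx
        · exact hk
      have hge : (Rp a b c : ℤ) ≤ Rpp a b c := by exact_mod_cast hlink a b c
      exact mul_nonneg hk (sub_nonneg.2 hge)
  -- (8) the two unit rows
  have hunit : L.G.zeta * ((R 0 0 0 : ℤ) - 1) + L.G.ups * ((R 0 w₀ 0 : ℤ) - 1) = 0 := by
    rw [hz0, hzu]; simp
  -- (9) nonpositivity of the coefficient sums
  have hnegABW : ∑ j ∈ range (n + 1), (coefAG n k d e path L.G j * (A j : ℤ) + coefBG n k d e path L.G j * (B j : ℤ) +
      coefWP n k d e path L j * (W j : ℤ)) ≤ 0 := by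
    refine Finset.sum_nonpos fun j hj => ?_
    obtain ⟨⟨ha, hb⟩, hw⟩ := hABW j (mem_range.1 hj)
    have e1 := mul_nonpos_of_nonpos_of_nonneg ha (Nat.cast_nonneg (A j) : (0 : ℤ) ≤ A j)
    have e2 := mul_nonpos_of_nonpos_of_nonneg hb (Nat.cast_nonneg (B j) : (0 : ℤ) ≤ B j)
    have e3 := mul_nonpos_of_nonpos_of_nonneg hw (Nat.cast_nonneg (W j) : (0 : ℤ) ≤ W j)
    linarith
  have hnegR : boxSum n w₀ (fun a b c => coefRP w₀ TT TT2 path L a b c * (R a b c : ℤ) +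
      coefRpP n k w₀ TP path L a b c * (Rp a b c : ℤ) + coefRppP n k e w₀ TP2 L a b c * (Rpp a b c : ℤ)) ≤ 0 := by
    refine boxSum_nonpos fun a ha b hb c hc => ?_
    by_cases hx : Odd c ∨ w₀ < b + c
    · rw [(hinv a b c hx).1, (hinv a b c hx).2, hinv2 a b c hx]; simp
    rcases hRRR a (mem_range.1 ha) b (mem_range.1 hb) c (mem_range.1 hc) with hbad | ⟨⟨⟨-, hr⟩, hrp⟩, hrpp⟩
    · exact absurd hbad hx
    have e1 := mul_nonpos_of_nonpos_of_nonneg hr (Nat.cast_nonneg (R a b c) : (0 : ℤ) ≤ R a b c)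
    have e2 := mul_nonpos_of_nonpos_of_nonneg hrp (Nat.cast_nonneg (Rp a b c) : (0 : ℤ) ≤ Rp a b c)
    have e3 := mul_nonpos_of_nonpos_of_nonneg hrpp (Nat.cast_nonneg (Rpp a b c) : (0 : ℤ) ≤ Rpp a b c)
    linarith
  -- (10) expand the coefficient sums into the row contributions
  have hexpABW := sum_coefABW_pair_expand (n := n) (k := k) (d := d) (e := e) path L A B W
  have hexpR := boxSum_coefR_pair_expand (n := n) (k := k) (e := e) (w₀ := w₀) TP TT TP2 TT2 path L R Rp Rpp
  -- the two unit rows as box sums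
  have hunitbox : boxSum n w₀ (fun a b c => (if a = 0 ∧ b = 0 ∧ c = 0 then L.G.zeta else 0) * (R a b c : ℤ) +
      (if a = 0 ∧ b = w₀ ∧ c = 0 then L.G.ups else 0) * (R a b c : ℤ)) = L.G.zeta * R 0 0 0 + L.G.ups * R 0 w₀ 0 := by
    rw [boxSum_add, boxSum_ite_eq n w₀ 0 (Nat.zero_le _) L.G.zeta (fun a b c => (R a b c : ℤ)),
      boxSum_ite_eq n w₀ w₀ le_rfl L.G.ups (fun a b c => (R a b c : ℤ))]
  -- combine
  have hrhs' : (0 : ℤ) < leafRhsG n k d e path L.G := hrhs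
  unfold leafRhsG at hrhs'
  linarith [hbase, hspl, hmargR, hmargRp, hmargW, hpts, hpts2', hzero, hzero2, htransR, htransRp, htransRpp,
    hcontain, hlink2, hunit, hnegABW, hnegR, hexpABW, hexpR, hunitbox]

/-- Soundness of the pair tree checker. Column: proved (ours). [cite: MacWilliamsSloane1977, Ch. 17 §4 Thm. 20] -/
theorem not_leafHypP_of_checkPathP (t : RTreeP) {path : List RSplit} (h : t.checkPathP n k d e w₀ path = true)
    (H : LeafHypP n k d e w₀ path A B W R Rp Rpp) : False := by
  induction t generalizing path with
  | leaf L => exact not_leafHypP_of_rleafOKP h H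
  | split ca cb cw cr crp v le ge ihl ihg =>
    simp only [RTreeP.checkPathP, Bool.and_eq_true] at h
    rcases rsplit_holds_or n w₀ ca cb cw cr crp v A B W R Rp with hl | hg
    · refine ihl h.1 ⟨H.sys, H.ref, H.ref2, H.link, fun s hs => ?_⟩
      rcases List.mem_append.1 hs with hs | hs
      · exact H.path s hs
      · rw [List.mem_singleton.1 hs]; exact hl
    · refine ihg h.2 ⟨H.sys, H.ref, H.ref2, H.link, fun s hs => ?_⟩
      rcases List.mem_append.1 hs with hs | hs
      · exact H.path s hs
      · rw [List.mem_singleton.1 hs]; exact hg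

/-- **Two checked pair certificates (one per parity branch) refute the refined system of the pair `(C, C′)`** —
UNCONDITIONAL (weak duality + integrality). Column: proved (ours). [cite: CalderbankEtAl1998, §7 (ii) (printed p. 28)] -/
theorem not_crssRefinedPairFeasible_of_checkP (t₀ t₁ : RTreeP) (h₀ : t₀.checkP n k d 0 w₀ = true)
    (h₁ : t₁.checkP n k d 1 w₀ = true) : ¬ CRSSRefinedPairFeasible n k d w₀ := by
  rintro ⟨A, B, W, e, R, Rp, Rpp, hsys, href, href2, hlink⟩
  have he := hsys.1
  interval_cases e
  · exact not_leafHypP_of_checkPathP (path := []) t₀ h₀ ⟨hsys, href, href2, hlink, fun s hs => by simp at hs⟩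
  · exact not_leafHypP_of_checkPathP (path := []) t₁ h₁ ⟨hsys, href, href2, hlink, fun s hs => by simp at hs⟩

end Soundness

/-! ### 3. Assembly: CRSS's two-stage argument with the even-subcode block -/

/-- **CRSS's two-stage special-bound argument with the even-subcode block, certified.** Let `zs` be a list of EVEN
weights. If (a) the plain integer system together with `A_w = 0` for all `w ∈ zs` is refuted by checked certificates
in both parity branches («linear programming shows that `C` must contain a vector of weight» in `zs`), and (b) for
every `w ∈ zs` the refined system of the pair `(C, C′)` with respect to a codeword of weight `w` is infeasible, then
there is no `[[n,k,d]]` additive code whose stabilizer space has no word of weight `1`. Column: proved (ours).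
[cite: CalderbankEtAl1998, §7 (ii)–(iii) (printed p. 28)] -/
theorem no_additiveCode_of_pairCerts {n k d : ℕ} (zs : List ℕ) (t₀ t₁ : IPTree) (h₀ : t₀.checkZ n k d 0 zs = true)
    (h₁ : t₁.checkZ n k d 1 zs = true) (hev : ∀ w ∈ zs, Even w) (href : ∀ w ∈ zs, ¬ CRSSRefinedPairFeasible n k d w)
    (S : Submodule (ZMod 2) (SympVec n)) (hS : IsAdditiveCode S k d) (hw1 : ∀ v ∈ S, sympWeight v ≠ 1) : False := by
  classical
  have hsys := hS.crssIntSystem hw1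
  have hz : ∀ w ∈ zs, wtDist S w = 0 := fun w hw =>
    hS.wtDist_eq_zero_of_not_crssRefinedPairFeasible hw1 (hev w hw) (href w hw)
  have he := hsys.1
  rcases Nat.le_one_iff_eq_zero_or_eq_one.1 he with he0 | he1
  · rw [he0] at hsys; exact not_sat_checkZ h₀ hsys hz
  · rw [he1] at hsys; exact not_sat_checkZ h₁ hsys hz

end Summit.Ventures.QEC.Census
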